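import Literature.Probability.FitznerVanDerHofstad2017.NobleBoundsNGrouped
import HarnessLib

/-!
# Fitzner–van der Hofstad (2017), §6.1 (6.4) at general `N`: junction packages — provider-side tools

[FvdH17] = R. Fitzner, R. van der Hofstad, *Mean-field behavior for nearest-neighbor percolation in `d > 10`*,
Electron. J. Probab. **22** (2017), no. 43, arXiv:1506.07977v2.

`NobleBoundsNGrouped` reduces the class estimate `h2` of `nobleXiT_le_recP_chain_of_jointWit` ([FvdH17, (6.4)
p. 58]) to LETTER PACKAGES `JPkg p (jctx … k) (JFacts …) tgt`, one per junction `k` of the bounding diagram.  This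
module collects the small tools the providers of such packages (the block estimates of [FvdH17, App. B]) need:

* §A transport: a package is contravariant in the facts and monotone in the target (`JPkg.mapFacts`,
  `JPkg.monoTgt`); the VACUOUS package (facts never hold: any target) and the TRIVIAL package (no upgrade, the
  joint witnesses themselves, target `1`; [FvdH17, (4.57)–(4.61)]: it shows the interface is satisfiable);
* §B the junction contexts in closed form: the views of levels `0`, `k + 1` (middle) and `M + 2` (last) of a
  variant piece as explicit records ([FvdH17, (4.57)–(4.61), (4.66)]), and the lower / upper view of each junction;
* §C accessors for the facts `JFacts` handed to a package: lattice configurations, the exit classes `a_i`, the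
  last class `c`, the inner classes `e_k`, admissibility, the side conditions of the two levels and of the
  junction, and the compatibility of the joint witness family with the junction context ([FvdH17, (4.57)–(4.66)]).

Everything is `d`-generic; no percolation estimate is asserted.

## References
* [FvdH17] arXiv:1506.07977v2: §4.4 (4.57)–(4.66) pp. 41–43; §6.1 (6.4) pp. 58–59; App. B pp. 74–78.
* [Gri99] G. Grimmett, *Percolation*, 2nd ed., Springer 1999, §2.3 Thm. (2.12), (2.17) (BK, product form).
-/

noncomputable section

namespace Literature.Probability.FitznerVanDerHofstad2017

open Literature.Barriers.CriticalPhenomena Literature.Probability.Percolation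
open Literature.Probability.LatticeModels Literature.Combinatorics.SimpleGraph _root_.SimpleGraph
open _root_.MeasureTheory
open Literature.Probability.FitznerVanDerHofstad2017.NobleBlocks (piPerc)
open Literature.Probability.FitznerVanDerHofstad2017.BlockSummation
open scoped ENNReal

variable {d : ℕ}

/-! ### A. Transport of packages; the vacuous and the trivial package -/

section Transport

variable {p : unitInterval} {K : ℕ} {C : JCtx d K}
  {F F' : (Fin K → BondConfig (Site d)) → (Fin K → Fin 6 → Set (Sym2 (Site d))) → Prop} {tgt tgt' : ℝ≥0∞}

/-- **A package is contravariant in the facts**: a package built from weaker facts `F'` (implied by `F`) is a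
package for `F`. [cite: FitznerVanDerHofstad2017, §6.1 (6.4) (arXiv:1506.07977v2 p. 58)] -/
def JPkg.mapFacts (P : JPkg p C F' tgt) (h : ∀ ω K₀, F ω K₀ → F' ω K₀) : JPkg p C F tgt where
  gl := P.gl
  A := P.A
  useB := P.useB
  useTZ := P.useTZ
  fin := P.fin
  memB := P.memB
  memTZ := P.memTZ
  htz hu ω K₀ hF := P.htz hu ω K₀ (h ω K₀ hF)
  wit ω K₀ hF := P.wit ω K₀ (h ω K₀ hF)
  bound := P.bound

/-- **A package is monotone in the target.** [cite: FitznerVanDerHofstad2017, §6.1 (6.4) (arXiv:1506.07977v2 p. 58)] -/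
def JPkg.monoTgt (P : JPkg p C F tgt) (h : tgt ≤ tgt') : JPkg p C F tgt' where
  gl := P.gl
  A := P.A
  useB := P.useB
  useTZ := P.useTZ
  fin := P.fin
  memB := P.memB
  memTZ := P.memTZ
  htz := P.htz
  wit := P.wit
  bound := P.bound.trans (mul_le_mul' le_rfl h)

/-- Transport of the existence of a package along weaker facts and a larger target. [folklore] -/
theorem JPkg.nonempty_of_nonempty (h : ∀ ω K₀, F ω K₀ → F' ω K₀) (ht : tgt' ≤ tgt)
    (hP : Nonempty (JPkg p C F' tgt')) : Nonempty (JPkg p C F tgt) :=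
  ⟨(hP.some.mapFacts h).monoTgt ht⟩

/-- Slot `0` of the upper level is always an active local line (every level has at least four lines).
[cite: FitznerVanDerHofstad2017, (4.57)–(4.61) (arXiv:1506.07977v2 p. 41)] -/
theorem JCtx.act_up_zero (C : JCtx d K) (useB useTZ : Bool) : C.Act useB useTZ (.up 0) := by
  refine ⟨Or.inr (by decide), ?_⟩
  show ¬ C.VU.kd.nLines ≤ ((0 : Fin 6) : ℕ)
  cases C.VU.kd <;> decide

/-- A labelled disjoint-occurrence event with an empty member event is empty. [folklore] -/
theorem genDisjOcc_eq_empty_of_eq_empty {ι : Type*} (A : ι → Set (BondConfig (Site d))) (c : ι → Fin K) (i : ι)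
    (hi : A i = ∅) : genDisjOcc A c = ∅ := by
  ext ω
  simp only [Set.mem_empty_iff_false, iff_false]
  rintro ⟨W, -, hW, -⟩
  have := hW i
  rw [hi] at this
  exact this

/-- **The VACUOUS package**: if the facts never hold (e.g. the classes handed to the provider are inconsistent
with the piece), a package with ANY target exists (all upgraded events empty).
[cite: FitznerVanDerHofstad2017, §6.1 (6.4) (arXiv:1506.07977v2 p. 58)] -/
def JPkg.vacuous (p : unitInterval) (C : JCtx d K)
    (F : (Fin K → BondConfig (Site d)) → (Fin K → Fin 6 → Set (Sym2 (Site d))) → Prop)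
    (hF : ∀ ω K₀, ¬ F ω K₀) (tgt : ℝ≥0∞) : JPkg p C F tgt where
  gl := id
  A := fun _ => ∅
  useB := false
  useTZ := false
  fin := fun _ _ h => h.elim
  memB := by simp
  memTZ := by simp
  htz := by simp
  wit ω K₀ h := (hF ω K₀ h).elim
  bound := by
    have h0 : piPerc d p K (genDisjOcc (fun i : {i : JIdx // C.Act false false i ∧ id i = .up 0} =>
        (∅ : Set (BondConfig (Site d)))) fun i => C.lv i.1) = 0 := by
      rw [genDisjOcc_eq_empty_of_eq_empty _ _ ⟨.up 0, C.act_up_zero false false, rfl⟩ rfl]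
      exact measure_empty
    rw [Finset.prod_eq_zero (Finset.mem_univ (JIdx.up 0)) h0]
    exact zero_le

/-- **Compatibility of a witness family `K₀` with a junction context**: the witnesses of the two levels read off
the levels' vacant bonds and are pairwise bond-disjoint within each level, the two levels are distinct, and the
upper witnesses avoid the forbidden bonds. [cite: FitznerVanDerHofstad2017, (4.57)–(4.61) and §4.4 after (4.65) (arXiv:1506.07977v2 pp. 41, 43)] -/
def JCtx.Compat (C : JCtx d K) (ω : Fin K → BondConfig (Site d)) (K₀ : Fin K → Fin 6 → Set (Sym2 (Site d))) :
    Prop :=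
  (∀ j, K₀ C.lo j ⊆ offBonds C.VL.off (ω C.lo)) ∧ (∀ j, K₀ C.up j ⊆ offBonds C.VU.off (ω C.up)) ∧
    (∀ j j', j ≠ j' → Disjoint (K₀ C.lo j) (K₀ C.lo j')) ∧ (∀ j j', j ≠ j' → Disjoint (K₀ C.up j) (K₀ C.up j')) ∧
    C.lo ≠ C.up ∧ (∀ j, ¬ IsTriv C.VU.kd j → Disjoint (K₀ C.up j) C.fb)

/-- **The TRIVIAL package**: no upgrade (`A = univ`), every active slot its own letter, witnesses the joint
witnesses themselves, no bond lines, target `1`.  It exists whenever the facts imply the compatibility of the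
witness family with the context; in particular the interface `JPkg` is satisfiable on every junction.
[cite: FitznerVanDerHofstad2017, (4.57)–(4.61) (arXiv:1506.07977v2 p. 41)] -/
def JPkg.trivial (p : unitInterval) (C : JCtx d K)
    (F : (Fin K → BondConfig (Site d)) → (Fin K → Fin 6 → Set (Sym2 (Site d))) → Prop)
    (hF : ∀ ω K₀, F ω K₀ → C.Compat ω K₀) : JPkg p C F 1 where
  gl := id
  A := fun _ => Set.univ
  useB := false
  useTZ := false
  fin := fun _ => isFinitary_univ
  memB := by simp
  memTZ := by simp
  htz := by simp
  wit ω K₀ h := by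
    obtain ⟨h1, h2, h3, h4, hlu, h5⟩ := hF ω K₀ h
    refine ⟨Sum.elim (K₀ C.lo) (K₀ C.up), ?_, ?_, ?_, ?_, ?_⟩
    · intro j _
      exact ⟨h1 j, Set.mem_univ _⟩
    · intro j _
      exact ⟨h2 j, Set.mem_univ _⟩
    · intro _ _
      exact subset_rfl
    · intro hl j hj
      have hj5 : j ≠ 5 := by
        rcases hj.1 with h' | h'
        · rw [hl] at h'; exact absurd h' (by decide)
        · exact h'
      exact ⟨h4 j 5 hj5, h5 j hj.2⟩
    · intro i i' hi hi' hne hrel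
      have hrel' : C.lv i = C.lv i' := by
        rcases hrel with h' | h'
        · exact h'
        · exact absurd h' hne
      cases i with
      | lo j =>
        cases i' with
        | lo j' => exact h3 j j' fun hjj => hne (by rw [hjj])
        | up j' => exact absurd hrel' hlu
        | xb => exact absurd hi' (by simp [JCtx.Act])
        | xtz => exact absurd hi' (by simp [JCtx.Act])
      | up j =>
        cases i' with
        | lo j' => exact absurd hrel'.symm hlu
        | up j' => exact h4 j j' fun hjj => hne (by rw [hjj])
        | xb => exact absurd hi' (by simp [JCtx.Act])
        | xtz => exact absurd hi' (by simp [JCtx.Act])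
      | xb => exact absurd hi (by simp [JCtx.Act])
      | xtz => exact absurd hi (by simp [JCtx.Act])
  bound := by
    rw [Bool.toNat_false, pow_zero, one_mul]
    exact Finset.prod_le_one' fun l _ => NobleBlocks.piPerc_le_one _ _ _

end Transport

/-! ### B. The junction contexts of a variant piece in closed form -/

section Views

variable (M : ℕ) (x : Site d) (b : Fin (M + 2) → Site d × Site d) (w t z : Fin (M + 2) → Site d)
  (a : Fin (M + 2) → Fin 3 ⊕ Unit) (τ : Fin (M + 1) → Bool × Fin 3)

/-- Level `0` of a variant piece (`F_0`): kind `zero`, entry `0`, end `b̲_0 = (b 0).1`, `b̄_0 = (b 0).2`, exit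
`w_0`, next through-point `z_1 = z 0`, the pivotal bond `b_0` removed.
[cite: FitznerVanDerHofstad2017, (4.57) (arXiv:1506.07977v2 p. 41)] -/
theorem pieceViews_zero :
    pieceViews M x b w t z a τ 0 = ⟨.zero, 0, 0, 0, 0, (b 0).1, (b 0).2, w 0, z 0, {s((b 0).1, (b 0).2)}⟩ :=
  rfl

/-- The variant bit of level `k + 1` is `(τ k).1`. [cite: FitznerVanDerHofstad2017, (4.59)–(4.61) (arXiv:1506.07977v2 p. 41)] -/
@[simp] theorem sigOf_succ (k : Fin (M + 1)) : sigOf M τ k.succ = (τ k).1 := by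
  simp [sigOf]

/-- The variant bit of level `0` is `false`. [folklore] -/
@[simp] theorem sigOf_zero : sigOf M τ 0 = false := by
  simp [sigOf]

/-- The junction type of level `i` is "closed" iff its exit class is `★`. [cite: FitznerVanDerHofstad2017, (4.62) (arXiv:1506.07977v2 p. 41)] -/
@[simp] theorem clsS_apply (i : Fin (M + 2)) : clsS M a i = (a i).isRight := rfl

/-- A middle level `k + 1` (`1 ≤ k + 1 ≤ M + 1`) of a variant piece: kind `midKind (a (k+1) = ★) (τ k).1`,
vacant vertex `u_k = (b k).1`, entry `v_k = (b k).2`, sausage pair `(t_k, z_k)`, end `u_{k+1}`, `b̄ = v_{k+1}`,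
exit `w_{k+1}`, next through-point `z_{k+1}`; removed bonds: those at `u_k` and the pivotal bond `b_{k+1}`.
[cite: FitznerVanDerHofstad2017, (4.59)–(4.62) (arXiv:1506.07977v2 p. 41)] -/
theorem pieceViews_mid (k : Fin (M + 1)) :
    pieceViews M x b w t z a τ k.castSucc.succ =
      ⟨midKind (a k.succ).isRight (τ k).1, (b k.castSucc).1, (b k.castSucc).2, t k.castSucc, z k.castSucc,
        (b k.succ).1, (b k.succ).2, w k.succ, z k.succ,
        bondsAt {(b k.castSucc).1} ∪ {s((b k.succ).1, (b k.succ).2)}⟩ := by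
  unfold pieceViews
  rw [ChainParams.topViews_castSucc_succ]
  simp only [ChainParams.midView, topParams, clsS, sigOf_succ]

/-- The last level `M + 2` (`F_N`): kind `last`, vacant vertex `u_{M+1}`, entry `v_{M+1}`, sausage pair
`(t_{M+1}, z_{M+1})`, end `x`; removed bonds: those at `u_{M+1}`.
[cite: FitznerVanDerHofstad2017, (4.58) (arXiv:1506.07977v2 p. 41)] -/
theorem pieceViews_last :
    pieceViews M x b w t z a τ (Fin.last (M + 2)) =
      ⟨.last, (b (Fin.last (M + 1))).1, (b (Fin.last (M + 1))).2, t (Fin.last (M + 1)), z (Fin.last (M + 1)),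
        x, x, x, x, bondsAt {(b (Fin.last (M + 1))).1}⟩ := by
  unfold pieceViews
  rw [ChainParams.topViews_last]
  rfl

/-- The lower view of junction `k` is level `k`. [folklore] -/
theorem jctx_VL (k : Fin (M + 2)) : (jctx M x b w t z a τ k).VL = pieceViews M x b w t z a τ k.castSucc := rfl

/-- The upper view of junction `k` is level `k + 1`. [folklore] -/
theorem jctx_VU (k : Fin (M + 2)) : (jctx M x b w t z a τ k).VU = pieceViews M x b w t z a τ k.succ := rfl

/-- The lower view of junction `0` is level `0`. [cite: FitznerVanDerHofstad2017, (4.57) (arXiv:1506.07977v2 p. 41)] -/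
theorem jctx_VL_zero : (jctx M x b w t z a τ 0).VL = pieceViews M x b w t z a τ 0 := rfl

/-- The upper view of junction `k` (`k ≤ M`) is the middle level `k + 1`. [cite: FitznerVanDerHofstad2017, (4.59)–(4.61) (arXiv:1506.07977v2 p. 41)] -/
theorem jctx_VU_castSucc (k : Fin (M + 1)) :
    (jctx M x b w t z a τ k.castSucc).VU = pieceViews M x b w t z a τ k.castSucc.succ := rfl

/-- The lower view of junction `k + 1` (`k ≤ M`) is the middle level `k + 1`. [cite: FitznerVanDerHofstad2017, (4.59)–(4.61) (arXiv:1506.07977v2 p. 41)] -/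
theorem jctx_VL_succ (k : Fin (M + 1)) :
    (jctx M x b w t z a τ k.succ).VL = pieceViews M x b w t z a τ k.castSucc.succ := by
  show pieceViews M x b w t z a τ k.succ.castSucc = _
  rw [Fin.succ_castSucc]

/-- The upper view of the last junction is the last level. [cite: FitznerVanDerHofstad2017, (4.58) (arXiv:1506.07977v2 p. 41)] -/
theorem jctx_VU_last :
    (jctx M x b w t z a τ (Fin.last (M + 1))).VU = pieceViews M x b w t z a τ (Fin.last (M + 2)) := by
  show pieceViews M x b w t z a τ (Fin.last (M + 1)).succ = _
  rw [Fin.succ_last]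

/-- The remaining fields of the context of junction `k`. [folklore] -/
theorem jctx_fields (k : Fin (M + 2)) :
    (jctx M x b w t z a τ k).lo = k.castSucc ∧ (jctx M x b w t z a τ k).up = k.succ ∧
      (jctx M x b w t z a τ k).bK = s((b k).1, (b k).2) ∧ (jctx M x b w t z a τ k).tz = (t k, z k) ∧
      (jctx M x b w t z a τ k).fb = fbN M t z k :=
  ⟨rfl, rfl, rfl, rfl, rfl⟩

/-- The two levels of a junction are distinct. [folklore] -/
theorem jctx_lo_ne_up (k : Fin (M + 2)) : (jctx M x b w t z a τ k).lo ≠ (jctx M x b w t z a τ k).up :=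
  fun h => (Fin.castSucc_lt_succ (i := k)).ne h

end Views

/-! ### C. Accessors for the facts handed to a package -/

section Facts

variable {M : ℕ} {x : Site d} {b : Fin (M + 2) → Site d × Site d} {w t z : Fin (M + 2) → Site d}
  {a : Fin (M + 2) → Fin 3 ⊕ Unit} {c : Fin 3 ⊕ Unit} {τ : Fin (M + 1) → Bool × Fin 3}
  {ω : Fin (M + 3) → BondConfig (Site d)} {K₀ : Fin (M + 3) → Fin 6 → Set (Sym2 (Site d))}

namespace JFacts

/-- The configuration lies in the variant piece. [folklore] -/
theorem mem (h : JFacts M x b w t z a c τ ω K₀) : ω ∈ jwPiece M x b w t z a c τ := h.1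

/-- `K₀` is a joint witness family. [cite: FitznerVanDerHofstad2017, (4.57)–(4.62) (arXiv:1506.07977v2 p. 41)] -/
theorem conds (h : JFacts M x b w t z a c τ ω K₀) : Conds (M + 2) (pieceViews M x b w t z a τ) ω K₀ := h.2

/-- The variant is admissible. [cite: FitznerVanDerHofstad2017, (4.62) (arXiv:1506.07977v2 p. 41)] -/
theorem admT (h : JFacts M x b w t z a c τ ω K₀) : AdmT M a τ := h.1.1

/-- Lattice configurations. [folklore] -/
theorem lattice (h : JFacts M x b w t z a c τ ω K₀) (i : Fin (M + 3)) : ω i ⊆ (zdGraph d).edgeSet := h.1.2.1 i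

/-- The configuration lies in the joint witness event. [cite: FitznerVanDerHofstad2017, (4.66) (arXiv:1506.07977v2 p. 43)] -/
theorem mem_jointWitN (h : JFacts M x b w t z a c τ ω K₀) :
    ω ∈ jointWitN (M + 1) (clsS M a) (sigOf M τ) b w t z x := h.1.2.2.1

/-- The exit class of an open level `i`: the line `(u_i, w_i)` read on level `i` has class `a_i`.
[cite: FitznerVanDerHofstad2017, §6.1 "Case a = 0, 1, 2" (arXiv:1506.07977v2 pp. 58–59)] -/
theorem exitClass (h : JFacts M x b w t z a c τ ω K₀) (i : Fin (M + 2)) (a₀ : Fin 3) (hi : a i = Sum.inl a₀) :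
    lineClass (b i).1 (w i) (ω i.castSucc) = a₀ := h.1.2.2.2.1 i a₀ hi

/-- The last class: `c` is the class of `(t_{M+1}, z_{M+1})` read on the last level (in particular `c ≠ ★`).
[cite: FitznerVanDerHofstad2017, §6.1 "Case b = 0, 1, 2" (arXiv:1506.07977v2 p. 59)] -/
theorem lastClass (h : JFacts M x b w t z a c τ ω K₀) :
    c = Sum.inl (lineClass (t (Fin.last (M + 1))) (z (Fin.last (M + 1))) (ω (Fin.last (M + 2)))) := h.1.2.2.2.2.1

/-- The inner class of junction `k ≤ M`: `(t_k, z_k)` read on level `k + 1` has class `(τ k).2`.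
[cite: FitznerVanDerHofstad2017, §6.1 "Case b = 0, 1, 2" (arXiv:1506.07977v2 p. 59)] -/
theorem innerClass (h : JFacts M x b w t z a c τ ω K₀) (k : Fin (M + 1)) :
    lineClass (t k.castSucc) (z k.castSucc) (ω k.castSucc.succ) = (τ k).2 := h.1.2.2.2.2.2 k

/-- The canonical identifications, vacancy inequalities and `b̄ ∉ C̃` of level `i`.
[cite: FitznerVanDerHofstad2017, (4.58)–(4.61), (4.64) (arXiv:1506.07977v2 pp. 41–42)] -/
theorem level (h : JFacts M x b w t z a c τ ω K₀) (i : Fin (M + 3)) :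
    (pieceViews M x b w t z a τ i).Canon ∧ (pieceViews M x b w t z a τ i).Vac ∧ (pieceViews M x b w t z a τ i).NotC :=
  level_of_mem_jointWitN h.mem_jointWitN i

/-- The clauses of junction `k`: `t_k ∉` the named vertices of level `k` unless `t_k = z_k`, and the pin of a
closed level. [cite: FitznerVanDerHofstad2017, (4.64)–(4.65) (arXiv:1506.07977v2 pp. 42–43)] -/
theorem junction (h : JFacts M x b w t z a c τ ω K₀) (k : Fin (M + 2)) :
    ((pieceViews M x b w t z a τ k.succ).z ≠ (pieceViews M x b w t z a τ k.succ).t →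
        (pieceViews M x b w t z a τ k.succ).t ∉ (pieceViews M x b w t z a τ k.castSucc).verts) ∧
      ((pieceViews M x b w t z a τ k.castSucc).kd = .closed →
        (pieceViews M x b w t z a τ k.succ).z = (pieceViews M x b w t z a τ k.castSucc).u ∧
          (pieceViews M x b w t z a τ k.castSucc).w = (pieceViews M x b w t z a τ k.succ).z) :=
  junction_of_mem_jointWitN h.mem_jointWitN k

/-- The sausage pair of level `k + 1` and the pivotal bond below it, in slot form.
[cite: FitznerVanDerHofstad2017, (4.66) (arXiv:1506.07977v2 p. 43)] -/
theorem views_succ (k : Fin (M + 2)) :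
    (pieceViews M x b w t z a τ k.succ).t = t k ∧ (pieceViews M x b w t z a τ k.succ).z = z k ∧
      (pieceViews M x b w t z a τ k.succ).u = (b k).1 ∧ (pieceViews M x b w t z a τ k.succ).v = (b k).2 :=
  topViews_succ_t (clsS M a) (sigOf M τ) b w t z x k

/-- The witnesses read off the vacant bonds of their level. [cite: FitznerVanDerHofstad2017, (4.57)–(4.61) (arXiv:1506.07977v2 p. 41)] -/
theorem off (h : JFacts M x b w t z a c τ ω K₀) (i : Fin (M + 3)) (j : Fin 6) :
    K₀ i j ⊆ offBonds (pieceViews M x b w t z a τ i).off (ω i) := h.2.1 i j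

/-- The witnesses witness their lines. [cite: FitznerVanDerHofstad2017, (4.57)–(4.61) (arXiv:1506.07977v2 p. 41)] -/
theorem conn (h : JFacts M x b w t z a c τ ω K₀) (i : Fin (M + 3)) (j : Fin 6) :
    K₀ i j ∈ (openConn ((pieceViews M x b w t z a τ i).line j).1 ((pieceViews M x b w t z a τ i).line j).2 :
      Set (BondConfig (Site d))) := h.2.2.1 i j

/-- The witnesses of one level are pairwise bond-disjoint. [cite: FitznerVanDerHofstad2017, (4.57)–(4.61) "∘" (arXiv:1506.07977v2 p. 41)] -/
theorem disj (h : JFacts M x b w t z a c τ ω K₀) (i : Fin (M + 3)) (j j' : Fin 6) (hj : j ≠ j') :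
    Disjoint (K₀ i j) (K₀ i j') := h.2.2.2.1 i j j' hj

/-- The entry witnesses of level `k + 1` avoid every witness of level `k`.
[cite: FitznerVanDerHofstad2017, §4.4 after (4.65) (arXiv:1506.07977v2 p. 43)] -/
theorem cross (h : JFacts M x b w t z a c τ ω K₀) (k : Fin (M + 2)) (j j' : Fin 6)
    (hj' : IsEntry (pieceViews M x b w t z a τ k.succ).kd j') : Disjoint (K₀ k.succ j') (K₀ k.castSucc j) :=
  h.2.2.2.2.1 k j j' hj'

/-- The sausage bond `{t_k, z_k}` (if genuine) is not a witness bond of level `k`.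
[cite: FitznerVanDerHofstad2017, (4.58)–(4.61) (arXiv:1506.07977v2 p. 41)] -/
theorem bond (h : JFacts M x b w t z a c τ ω K₀) (k : Fin (M + 2)) (j : Fin 6) (htz : t k ≠ z k) :
    s(t k, z k) ∉ K₀ k.castSucc j := by
  have h5 := h.2.2.2.2.2.1 k j
  rw [(views_succ (x := x) (b := b) (w := w) (a := a) (τ := τ) k).1,
    (views_succ (x := x) (b := b) (w := w) (a := a) (τ := τ) k).2.1] at h5
  exact h5 htz.symm

/-- The upper witnesses of junction `k` avoid the forbidden bonds `fbN k` (the sausage bond of level `k + 2`).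
[cite: FitznerVanDerHofstad2017, (4.58)–(4.61) (arXiv:1506.07977v2 p. 41)] -/
theorem disjoint_fbN (h : JFacts M x b w t z a c τ ω K₀) (k : Fin (M + 2)) (j : Fin 6) :
    Disjoint (K₀ k.succ j) (fbN M t z k) := by
  rw [Set.disjoint_iff]
  rintro e ⟨he, k', hk', hne, rfl⟩
  have := h.bond k' j hne
  rw [hk'] at this
  exact this he

/-- **The joint witness family is compatible with every junction context** (so the trivial package exists on
every junction of every piece). [cite: FitznerVanDerHofstad2017, (4.57)–(4.61) and §4.4 after (4.65) (arXiv:1506.07977v2 pp. 41, 43)] -/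
theorem compat (h : JFacts M x b w t z a c τ ω K₀) (k : Fin (M + 2)) : (jctx M x b w t z a τ k).Compat ω K₀ :=
  ⟨fun j => h.off k.castSucc j, fun j => h.off k.succ j, fun j j' hj => h.disj k.castSucc j j' hj,
    fun j j' hj => h.disj k.succ j j' hj, jctx_lo_ne_up M x b w t z a τ k, fun j _ => h.disjoint_fbN k j⟩

end JFacts

/-- **The trivial package exists on every junction of every variant piece** (target `1`): the interface of
`NobleBoundsNGrouped` is satisfiable. [cite: FitznerVanDerHofstad2017, (4.57)–(4.61) (arXiv:1506.07977v2 p. 41)] -/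
theorem nonempty_jPkg_trivial (p : unitInterval) (M : ℕ) (x : Site d) (b : Fin (M + 2) → Site d × Site d)
    (w t z : Fin (M + 2) → Site d) (a : Fin (M + 2) → Fin 3 ⊕ Unit) (c : Fin 3 ⊕ Unit)
    (τ : Fin (M + 1) → Bool × Fin 3) (k : Fin (M + 2)) :
    Nonempty (JPkg p (jctx M x b w t z a τ k) (JFacts M x b w t z a c τ) 1) :=
  ⟨JPkg.trivial p _ _ fun _ _ h => h.compat k⟩

/-- Consequently the skeleton bound holds with all targets `1`: `p^{M+2} · ℙ^{⊗(M+3)}(W_τ) ≤ 1` (a sanity check of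
the orientation of the interface, not an estimate). [folklore] -/
theorem pow_mul_piPerc_jwPiece_le_one (p : unitInterval) (M : ℕ) (x : Site d) (b : Fin (M + 2) → Site d × Site d)
    (w t z : Fin (M + 2) → Site d) (a : Fin (M + 2) → Fin 3 ⊕ Unit) (c : Fin 3 ⊕ Unit)
    (τ : Fin (M + 1) → Bool × Fin 3) (hb : ∀ k, s((b k).1, (b k).2) ∈ (zdGraph d).edgeSet) :
    ENNReal.ofReal p ^ (M + 2) * piPerc d p (M + 3) (jwPiece M x b w t z a c τ) ≤ 1 := by
  refine (pow_mul_piPerc_jwPiece_le_prod p M x b w t z a c τ (fun _ => (1 : ℝ≥0∞)) hb fun k =>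
    JPkg.trivial p _ _ fun _ _ h => h.compat k).trans ?_
  simp

end Facts

end Literature.Probability.FitznerVanDerHofstad2017
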